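import Literature.Computability.Complexity.HardcoreInapproximabilityCyclesOrbits
import HarnessLib

/-!
# Short cycles of Sly's random bipartite core, III: factorial counts of cycles

Allan Sly, *Computational transition at the uniqueness threshold*, FOCS 2010 (arXiv:1005.5584), §3.2
(Lemma 3.7, after MWW09 Lemma 7.3).

With the `2j` representatives `SlyWCycle.reps` of `HardcoreInapproximabilityCyclesOrbits`, the
falling factorial `(2j)^m (X_{2j})_m` of the number of `2j`-cycles present in a realisation is the
number `slyDistinctTuples … m` of ordered `m`-tuples of present rooted oriented cycles with pairwise
distinct underlying cycles, and `slyDistinctTuples_eq_prod` identifies it with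
`R (R - 2j) ⋯ (R - 2j(m-1))`, `R = slyRootedCycles` — the combinatorial form in which the factorial
moments `E[X_i]_m` of Lemma 3.7 are computed (sums over tuples of cycles of presence probabilities).
[cite: Sly2010, Lemma 3.7]
-/

namespace Literature.Computability.Complexity

open Finset

section FactorialCount

variable {n m' q j : ℕ}

open scoped Classical in
/-- **`(2j)^m (X_{2j})_m` without quotients**: the number of ordered `m`-tuples of rooted oriented
`2j`-cycles present in `G̃(σ,τ)` whose underlying cycles (= sets of representatives) are pairwise
distinct. [cite: Sly2010, Lemma 3.7 (factorial moments `E[X_i]_m`)] -/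
noncomputable def slyDistinctTuples (n m' q j m : ℕ) (σ : Fin q → Equiv.Perm (Fin (n + m'))) (τ : Equiv.Perm (Fin n)) : ℕ :=
  (univ.filter fun f : Fin m → SlyWCycle n q j =>
    (∀ k, (f k).Present σ τ) ∧ ∀ k l, k ≠ l → (f k).reps ≠ (f l).reps).card

open scoped Classical in
/-- The cycles allowed to extend a tuple: present, and not a representative of any member; there are
`R - 2jm` of them. [folklore] -/
theorem card_allowed_extension (hj : 0 < j) {m : ℕ} (σ : Fin q → Equiv.Perm (Fin (n + m'))) (τ : Equiv.Perm (Fin n))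
    (f : Fin m → SlyWCycle n q j) (hf : ∀ k, (f k).Present σ τ) (hd : ∀ k l, k ≠ l → (f k).reps ≠ (f l).reps) :
    (univ.filter fun C : SlyWCycle n q j => C.Present σ τ ∧ ∀ k, C.reps ≠ (f k).reps).card =
      slyRootedCycles n m' q j σ τ - 2 * j * m := by
  set P := univ.filter fun C : SlyWCycle n q j => C.Present σ τ with hP
  set F := (univ : Finset (Fin m)).biUnion fun k => (f k).reps with hF
  have hFP : F ⊆ P := by
    intro D hD
    rw [hF, Finset.mem_biUnion] at hD
    obtain ⟨k, -, hk⟩ := hD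
    rw [hP, Finset.mem_filter]
    exact ⟨Finset.mem_univ _, (SlyWCycle.present_of_mem_reps hk σ τ).2 (hf k)⟩
  have hFcard : F.card = 2 * j * m := by
    rw [hF, Finset.card_biUnion]
    · simp_rw [SlyWCycle.card_reps hj]
      rw [Finset.sum_const, Finset.card_univ, Fintype.card_fin, smul_eq_mul, Nat.mul_comm]
    · intro k _ l _ hkl
      rw [Function.onFun, Finset.disjoint_left]
      intro D h1 h2
      exact hd k l hkl ((SlyWCycle.reps_eq_of_mem_reps hj h1).symm.trans (SlyWCycle.reps_eq_of_mem_reps hj h2))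
  have hset : (univ.filter fun C : SlyWCycle n q j => C.Present σ τ ∧ ∀ k, C.reps ≠ (f k).reps) = P \ F := by
    ext C
    rw [Finset.mem_sdiff, hP, Finset.mem_filter, Finset.mem_filter, hF, Finset.mem_biUnion]
    simp only [Finset.mem_univ, true_and, not_exists]
    constructor
    · rintro ⟨hC, hk⟩
      exact ⟨hC, fun k hCk => hk k (SlyWCycle.reps_eq_of_mem_reps hj hCk)⟩
    · rintro ⟨hC, hk⟩
      refine ⟨hC, fun k heq => hk k ?_⟩
      rw [← heq]
      exact SlyWCycle.self_mem_reps hj C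
  rw [hset, Finset.card_sdiff_of_subset hFP, hFcard]
  rfl

open scoped Classical in
/-- Splitting an `(m+1)`-tuple into its initial `m`-tuple and its last entry. [folklore] -/
theorem slyDistinctTuples_succ (hj : 0 < j) (m : ℕ) (σ : Fin q → Equiv.Perm (Fin (n + m'))) (τ : Equiv.Perm (Fin n)) :
    slyDistinctTuples n m' q j (m + 1) σ τ = slyDistinctTuples n m' q j m σ τ * (slyRootedCycles n m' q j σ τ - 2 * j * m) := by
  unfold slyDistinctTuples
  -- predicate on tuples
  let Pm : (Fin m → SlyWCycle n q j) → Prop := fun f => (∀ k, (f k).Present σ τ) ∧ ∀ k l, k ≠ l → (f k).reps ≠ (f l).reps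
  let A : (Fin m → SlyWCycle n q j) → SlyWCycle n q j → Prop := fun f C => C.Present σ τ ∧ ∀ k, C.reps ≠ (f k).reps
  -- the split equivalence
  have key : ∀ g : Fin (m + 1) → SlyWCycle n q j,
      ((∀ k, (g k).Present σ τ) ∧ ∀ k l, k ≠ l → (g k).reps ≠ (g l).reps) ↔ Pm (Fin.init g) ∧ A (Fin.init g) (g (Fin.last m)) := by
    intro g
    constructor
    · rintro ⟨h1, h2⟩
      refine ⟨⟨fun k => h1 _, fun k l hkl => h2 _ _ (fun h => hkl (Fin.castSucc_injective _ h))⟩, h1 _, fun k => ?_⟩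
      exact h2 _ _ (fun h => (Fin.castSucc_lt_last k).ne' h)
    · rintro ⟨⟨h1, h2⟩, h3, h4⟩
      refine ⟨fun k => Fin.lastCases h3 (fun i => h1 i) k, fun k l => ?_⟩
      refine Fin.lastCases (Fin.lastCases (fun h => absurd rfl h) (fun i _ => (h4 i)) l) (fun i => ?_) k
      refine Fin.lastCases (fun _ => (h4 i).symm) (fun i' hkl => h2 i i' (fun h => hkl (by rw [h]))) l
  have e : {g : Fin (m + 1) → SlyWCycle n q j // (∀ k, (g k).Present σ τ) ∧ ∀ k l, k ≠ l → (g k).reps ≠ (g l).reps} ≃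
      {p : (Fin m → SlyWCycle n q j) × SlyWCycle n q j // Pm p.1 ∧ A p.1 p.2} :=
    { toFun := fun g => ⟨(Fin.init g.1, g.1 (Fin.last m)), (key g.1).1 g.2⟩
      invFun := fun p => ⟨Fin.snoc p.1.1 p.1.2, (key _).2 (by simpa only [Fin.init_snoc, Fin.snoc_last] using p.2)⟩
      left_inv := fun g => Subtype.ext (Fin.snoc_init_self g.1)
      right_inv := fun p => by
        apply Subtype.ext
        simp only [Fin.init_snoc, Fin.snoc_last] }
  rw [← Fintype.card_subtype, Fintype.card_congr e, Fintype.card_subtype]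
  -- count the pairs fibrewise
  rw [show (univ.filter fun p : (Fin m → SlyWCycle n q j) × SlyWCycle n q j => Pm p.1 ∧ A p.1 p.2) =
      (univ.filter Pm).biUnion (fun f => (univ.filter (A f)).map ⟨fun C => (f, C), fun C C' h => (Prod.mk.inj h).2⟩) from ?_]
  · rw [Finset.card_biUnion]
    · have : ∀ f ∈ univ.filter Pm, ((univ.filter (A f)).map ⟨fun C => (f, C), fun C C' h => (Prod.mk.inj h).2⟩).card =
          slyRootedCycles n m' q j σ τ - 2 * j * m := by
        intro f hf
        rw [Finset.card_map]
        exact card_allowed_extension hj σ τ f (Finset.mem_filter.1 hf).2.1 (Finset.mem_filter.1 hf).2.2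
      rw [Finset.sum_congr rfl this, Finset.sum_const, smul_eq_mul]
    · intro f _ f' _ hff'
      rw [Function.onFun, Finset.disjoint_left]
      intro p h1 h2
      rw [Finset.mem_map] at h1 h2
      obtain ⟨C, -, rfl⟩ := h1
      obtain ⟨C', -, h⟩ := h2
      exact hff' (Prod.mk.inj h).1.symm
  · ext p
    simp only [Finset.mem_filter, Finset.mem_univ, true_and, Finset.mem_biUnion, Finset.mem_map, Function.Embedding.coeFn_mk]
    constructor
    · rintro ⟨h1, h2⟩; exact ⟨p.1, h1, p.2, h2, rfl⟩
    · rintro ⟨f, hf, C, hC, rfl⟩; exact ⟨hf, hC⟩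

open scoped Classical in
/-- **`(2j)^m (X_{2j})_m = R (R - 2j) (R - 4j) ⋯ (R - 2j(m-1))`** on every realisation. [cite: Sly2010, Lemma 3.7] -/
theorem slyDistinctTuples_eq_prod (hj : 0 < j) (m : ℕ) (σ : Fin q → Equiv.Perm (Fin (n + m'))) (τ : Equiv.Perm (Fin n)) :
    slyDistinctTuples n m' q j m σ τ = ∏ k ∈ Finset.range m, (slyRootedCycles n m' q j σ τ - 2 * j * k) := by
  induction m with
  | zero =>
    unfold slyDistinctTuples
    simp
  | succ m ih => rw [slyDistinctTuples_succ hj, ih, Finset.prod_range_succ]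

end FactorialCount

end Literature.Computability.Complexity
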